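import Literature.Geometry.Lorentzian.ADMTransitionRotation
import Literature.Geometry.Lorentzian.ADMFrameIndependence
import Mathlib.Analysis.SpecialFunctions.SmoothTransition
import Mathlib.Analysis.InnerProductSpace.Calculus
import HarnessLib

/-!
# Transformation of the ADM flux density under a change of the structure at infinity

Support file (all results proved) for Bartnik's uniqueness theorem for the ADM energy
(`AFEnd.HasADMEnergy.Of_isSameEnd`; Bartnik, CPAM 39 (1986), Thm. 4.2, (4.8)–(4.9)). In the
setting of `TransitionRigidity.TransitionDecay h h' G G' α K R S` (two charts of the same end,
`x = G(y)`, `h'(y)(v,w) = h(Gy)(DG v, DG w)`) with asymptotic rotation `O` of `G`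
(`TransitionDecay.exists_rotation`), we compare the ADM flux density fields
`V = ∑ᵢ (∑ⱼ (∂ⱼhᵢⱼ − ∂ᵢhⱼⱼ)) bᵢ` of `h` and `V'` of `h'` pointwise on far round spheres of the
`y`-chart:

  `V'(y) = O⁻¹ V(G y) + c(y) + O(‖y‖^{−2α−1})`,  `V(G y) = V(O y) + O(‖y‖^{−2α−1})`,

where `c` is the ADM vector of the **antisymmetric** family `β(z)(v, w) = ⟪Ov, DG(z)w⟫ − ⟪Ow, DG(z)v⟫`
(`curlGen`), i.e. a curl field whose flux through round spheres vanishes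
(`ADMFrameIndependence.sphereIntegral_admVec_eq_zero_of_antisymm`). Consequently
(`abs_flux_density_sub_le`)

  `|⟪y/‖y‖, V'(y)⟫ − ⟪Oy/‖Oy‖, V(Oy)⟫ − ⟪y/‖y‖, c̃(y)⟫| ≤ C ‖y‖^{−2α−1}`   (`‖y‖ ≥ S⋆`),

with `c̃` the ADM vector of a globally `C²` cut-off `β̃` of `β`. This is Bartnik's computation
(4.8)–(4.9) ("a curious cancellation"): the flux forms of the two structures differ by an exact
form plus `o(r^{−(n−1)})`, here organised so that only round spheres in each chart are needed.

## References

* R. Bartnik, *The mass of an asymptotically flat manifold*, CPAM 39 (1986), §4, (4.8)–(4.9),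
  Thm. 4.2.
* P. T. Chruściel, *Boundary conditions at spatial infinity from a Hamiltonian point of view*
  (1986), §3.
-/

noncomputable section

-- instance search on the nested operator spaces `E →L[ℝ] E →L[ℝ] E →L[ℝ] ℝ` is deep
set_option maxSynthPendingDepth 3

open Set Filter Metric ContinuousLinearMap Finset
open scoped Topology RealInnerProductSpace ContDiff

namespace Literature.Geometry.Lorentzian

namespace TransitionRigidity

variable {E : Type*} [NormedAddCommGroup E] [InnerProductSpace ℝ E]

/-! ### The antisymmetric form `β = ⟪O·, P·⟫ − ⟪O·, P·⟫ᵀ` -/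

/-- **The curl generator**: for a linear isometry `O`, the continuous linear map sending
`P : E →L E` to the antisymmetric bilinear form `(v, w) ↦ ⟪O v, P w⟫ − ⟪O w, P v⟫`. For
`P = DG(z)` (`G = O + f` the transition map) this is `∂_w(O⁻¹f)_v − ∂_v(O⁻¹f)_w`, the `2`-form
whose divergence is the exact part of the difference of the two ADM flux densities,
Bartnik 1986, (4.8)–(4.9). [cite: Bartnik1986, §4, (4.8)–(4.9)] -/
def curlGen (O : E ≃ₗᵢ[ℝ] E) : (E →L[ℝ] E) →L[ℝ] (E →L[ℝ] E →L[ℝ] ℝ) :=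
  let Oc : E →L[ℝ] E := ((O.toContinuousLinearEquiv : E ≃L[ℝ] E) : E →L[ℝ] E)
  let Bf : E →L[ℝ] E →L[ℝ] ℝ := ((innerSL ℝ : E →L[ℝ] E →L[ℝ] ℝ).comp Oc).flip
  let Fl : (E →L[ℝ] E →L[ℝ] ℝ) →L[ℝ] (E →L[ℝ] E →L[ℝ] ℝ) :=
    ((flipₗᵢ ℝ E E ℝ).toContinuousLinearEquiv : (E →L[ℝ] E →L[ℝ] ℝ) →L[ℝ] (E →L[ℝ] E →L[ℝ] ℝ))
  let Φ : (E →L[ℝ] E) →L[ℝ] (E →L[ℝ] E →L[ℝ] ℝ) := Fl.comp (compL ℝ E E (E →L[ℝ] ℝ) Bf)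
  Φ - Fl.comp Φ

/-- `curlGen O P (v, w) = ⟪O v, P w⟫ − ⟪O w, P v⟫`. [folklore] -/
@[simp]
theorem curlGen_apply (O : E ≃ₗᵢ[ℝ] E) (P : E →L[ℝ] E) (v w : E) :
    curlGen O P v w = ⟪O v, P w⟫ - ⟪O w, P v⟫ := by
  simp [curlGen, compL_apply, coe_flipₗᵢ]

/-- `curlGen O P` is antisymmetric. [folklore] -/
theorem curlGen_antisymm (O : E ≃ₗᵢ[ℝ] E) (P : E →L[ℝ] E) (v w : E) :
    curlGen O P v w = -curlGen O P w v := by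
  rw [curlGen_apply, curlGen_apply]; ring

/-- Smoothness of `z ↦ curlGen O (DG(z))`: if `G` is `C^∞` at `z` then so is
`z ↦ curlGen O (DG z)`. [folklore] -/
theorem contDiffAt_curlGen_fderiv (O : E ≃ₗᵢ[ℝ] E) {G : E → E} {z : E}
    (hG : ContDiffAt ℝ ∞ G z) : ContDiffAt ℝ ∞ (fun z ↦ curlGen O (fderiv ℝ G z)) z := by
  have hP : ContDiffAt ℝ ∞ (fderiv ℝ G) z := hG.fderiv_right (m := ∞) le_rfl
  exact (curlGen O).contDiff.contDiffAt.comp z hP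

/-- **The derivative of the components of `β(z) = curlGen O (DG z)`**: at a `C²` point of `G`,
`∂ᵤ[β(·)(v, w)](y) = ⟪O v, D²G(y)(u, w)⟫ − ⟪O w, D²G(y)(u, v)⟫`. [folklore] -/
theorem fderiv_curlGen_fderiv_apply (O : E ≃ₗᵢ[ℝ] E) {G : E → E} {y : E}
    (hG : ContDiffAt ℝ 2 G y) (u v w : E) :
    fderiv ℝ (fun z ↦ curlGen O (fderiv ℝ G z) v w) y u =
      ⟪O v, fderiv ℝ (fderiv ℝ G) y u w⟫ - ⟪O w, fderiv ℝ (fderiv ℝ G) y u v⟫ := by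
  have hP : HasFDerivAt (fun z ↦ fderiv ℝ G z) (fderiv ℝ (fderiv ℝ G) y) y :=
    ((hG.fderiv_right (m := 1) le_rfl).differentiableAt one_ne_zero).hasFDerivAt
  have hβ : HasFDerivAt (fun z ↦ curlGen O (fderiv ℝ G z))
      ((curlGen O).comp (fderiv ℝ (fderiv ℝ G) y)) y :=
    (curlGen O).hasFDerivAt.comp y hP
  have hd : DifferentiableAt ℝ (fun z ↦ curlGen O (fderiv ℝ G z)) y := hβ.differentiableAt
  rw [OpensChart.fderiv_apply₂ _ hd v w u, hβ.fderiv]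
  simp only [ContinuousLinearMap.comp_apply, curlGen_apply]

/-! ### A smooth radial cut-off and the globally `C²` curl form -/

/-- A smooth radial cut-off on an inner product space: `χ = 0` on `‖x‖ ≤ ρ + 1`, `χ = 1` on
`ρ + 2 ≤ ‖x‖` (`ρ ≥ 0`; Mathlib's `Real.smoothTransition` of an affine function of `‖x‖²`).
[folklore] -/
theorem exists_smooth_radial_cutoff {ρ : ℝ} (hρ : 0 ≤ ρ) :
    ∃ χ : E → ℝ, ContDiff ℝ ∞ χ ∧ (∀ x, ‖x‖ ≤ ρ + 1 → χ x = 0) ∧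
      ∀ x, ρ + 2 ≤ ‖x‖ → χ x = 1 := by
  have hden : 0 < (ρ + 2) ^ 2 - (ρ + 1) ^ 2 := by nlinarith
  refine ⟨fun x ↦ Real.smoothTransition ((‖x‖ ^ 2 - (ρ + 1) ^ 2) / ((ρ + 2) ^ 2 - (ρ + 1) ^ 2)),
    ?_, fun x hx ↦ ?_, fun x hx ↦ ?_⟩
  · exact Real.smoothTransition.contDiff.comp
      (((contDiff_norm_sq ℝ).sub contDiff_const).div_const _)
  · refine Real.smoothTransition.zero_of_nonpos (div_nonpos_of_nonpos_of_nonneg ?_ hden.le)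
    have h1 : ‖x‖ ^ 2 ≤ (ρ + 1) ^ 2 := pow_le_pow_left₀ (norm_nonneg x) hx 2
    linarith
  · refine Real.smoothTransition.one_of_one_le ((one_le_div hden).2 ?_)
    have h1 : (ρ + 2) ^ 2 ≤ ‖x‖ ^ 2 := pow_le_pow_left₀ (by linarith) hx 2
    linarith

/-- **A globally `C²` antisymmetric cut-off of the curl form.** If `G` is smooth on `{S < ‖z‖}`
(`S ≥ 0`), there is a `C²` family `β̃` of antisymmetric bilinear forms on all of `E`, vanishing on
the closed ball of radius `S + 1`, which agrees with `β(z) = curlGen O (DG z)` near every point of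
`{S + 2 < ‖z‖}` (namely `β̃ = χ β` with a radial cut-off `χ`). [folklore] -/
theorem exists_cutoff_curlGen (O : E ≃ₗᵢ[ℝ] E) {G : E → E} {S : ℝ} (hS : 0 ≤ S)
    (hG : ∀ z : E, S < ‖z‖ → ContDiffAt ℝ ∞ G z) :
    ∃ β : E → E →L[ℝ] E →L[ℝ] ℝ, ContDiff ℝ 2 β ∧ (∀ z v w, β z v w = -β z w v) ∧
      (∀ z, ‖z‖ ≤ S + 1 → β z = 0) ∧
      ∀ z, S + 2 < ‖z‖ → β =ᶠ[𝓝 z] fun z ↦ curlGen O (fderiv ℝ G z) := by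
  obtain ⟨χ, hχ, hχ0, hχ1⟩ := exists_smooth_radial_cutoff (E := E) hS
  refine ⟨fun z ↦ χ z • curlGen O (fderiv ℝ G z), ?_, fun z v w ↦ ?_, fun z hz ↦ ?_,
    fun z hz ↦ ?_⟩
  · refine contDiff_iff_contDiffAt.2 fun z ↦ ?_
    by_cases hz : S < ‖z‖
    · exact ((hχ.contDiffAt.smul (contDiffAt_curlGen_fderiv O (hG z hz))).of_le
        (WithTop.coe_le_coe.mpr le_top))
    · push Not at hz
      have hzero : (fun z ↦ χ z • curlGen O (fderiv ℝ G z)) =ᶠ[𝓝 z]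
          fun _ ↦ (0 : E →L[ℝ] E →L[ℝ] ℝ) := by
        have hball : ball (0 : E) (S + 1) ∈ 𝓝 z :=
          isOpen_ball.mem_nhds (mem_ball_zero_iff.2 (by linarith))
        filter_upwards [hball] with x hx
        rw [hχ0 x (mem_ball_zero_iff.1 hx).le, zero_smul]
      exact contDiffAt_const.congr_of_eventuallyEq hzero
  · simp only [_root_.smul_apply, smul_eq_mul, curlGen_apply]
    ring
  · simp only [hχ0 z hz, zero_smul]
  · have hopen : IsOpen {x : E | S + 2 < ‖x‖} := isOpen_lt continuous_const continuous_norm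
    filter_upwards [hopen.mem_nhds hz] with x hx
    simp only [hχ1 x (le_of_lt hx), one_smul]

/-! ### Pointwise algebra of the error term -/

section ErrorAlgebra

variable {h₀ : E →L[ℝ] E →L[ℝ] ℝ} {P Oc : E →L[ℝ] E} {S : E →L[ℝ] E →L[ℝ] E}
  {τ τ' : E →L[ℝ] E →L[ℝ] E →L[ℝ] ℝ}

/-- **The error term of the transformed flux density.** With the differentiated law
`τ'(u,v,w) = τ(Pu,Pv,Pw) + h(S(u,v),Pw) + h(Pv,S(u,w))`, `‖P‖ ≤ 2` and `‖O‖ ≤ 1`,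
the quantity `τ'(u,v,w) − τ(Ou,Ov,Ow) − (⟪S(u,v), Ow⟫ + ⟪Ov, S(u,w)⟫)` is bounded by
`(7‖τ‖‖P−O‖ + 4‖h−δ‖‖S‖ + 2‖S‖‖P−O‖) ‖u‖‖v‖‖w‖`. Bartnik 1986, (4.8). [cite: Bartnik1986, §4, (4.8)] -/
theorem abs_error_le (hP : ‖P‖ ≤ 2) (hO : ‖Oc‖ ≤ 1)
    (hdlaw : ∀ u v w, τ' u v w = τ (P u) (P v) (P w) + h₀ (S u v) (P w) + h₀ (P v) (S u w))
    (u v w : E) :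
    |τ' u v w - τ (Oc u) (Oc v) (Oc w) - (⟪S u v, Oc w⟫ + ⟪Oc v, S u w⟫)| ≤
      (7 * ‖τ‖ * ‖P - Oc‖ + 4 * ‖h₀ - innerSL ℝ‖ * ‖S‖ + 2 * ‖S‖ * ‖P - Oc‖) *
        ‖u‖ * ‖v‖ * ‖w‖ := by
  set Q := P - Oc with hQ
  set k₀ := h₀ - innerSL ℝ with hk
  have hPQ : ∀ a, P a = Oc a + Q a := fun a ↦ by simp [hQ]
  have hk₀ : ∀ a c, h₀ a c = ⟪a, c⟫ + k₀ a c := fun a c ↦ by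
    rw [hk, _root_.sub_apply, _root_.sub_apply, innerSL_apply_apply]; ring
  -- rewrite the error as a sum of small terms
  have heq : τ' u v w - τ (Oc u) (Oc v) (Oc w) - (⟪S u v, Oc w⟫ + ⟪Oc v, S u w⟫) =
      (τ (Q u) (P v) (P w) + τ (Oc u) (Q v) (P w) + τ (Oc u) (Oc v) (Q w)) +
      (k₀ (S u v) (P w) + k₀ (P v) (S u w)) + (⟪S u v, Q w⟫ + ⟪Q v, S u w⟫) := by
    rw [hdlaw, hk₀ (S u v), hk₀ (P v), hPQ u]
    simp only [map_add, _root_.add_apply]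
    rw [hPQ v]
    simp only [map_add, _root_.add_apply, inner_add_left]
    rw [hPQ w]
    simp only [map_add, inner_add_right]
    ring
  rw [heq]
  -- norms of the building blocks
  have nP : ∀ a, ‖P a‖ ≤ 2 * ‖a‖ := fun a ↦ (le_opNorm _ _).trans (by gcongr)
  have nO : ∀ a, ‖Oc a‖ ≤ ‖a‖ := fun a ↦
    (le_opNorm _ _).trans (by nlinarith [norm_nonneg a])
  have nQ : ∀ a, ‖Q a‖ ≤ ‖Q‖ * ‖a‖ := fun a ↦ le_opNorm _ _
  have nS : ∀ a c, ‖S a c‖ ≤ ‖S‖ * ‖a‖ * ‖c‖ := fun a c ↦ S.le_opNorm₂ a c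
  have nτ : ∀ a c d, |τ a c d| ≤ ‖τ‖ * ‖a‖ * ‖c‖ * ‖d‖ := fun a c d ↦ by
    rw [← Real.norm_eq_abs]
    calc ‖τ a c d‖ ≤ ‖τ a c‖ * ‖d‖ := le_opNorm _ _
      _ ≤ ‖τ a‖ * ‖c‖ * ‖d‖ := by gcongr; exact le_opNorm _ _
      _ ≤ ‖τ‖ * ‖a‖ * ‖c‖ * ‖d‖ := by gcongr; exact le_opNorm _ _
  have nk : ∀ a c, |k₀ a c| ≤ ‖k₀‖ * ‖a‖ * ‖c‖ := fun a c ↦ by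
    rw [← Real.norm_eq_abs]; exact k₀.le_opNorm₂ a c
  -- the three groups
  have e1 : |τ (Q u) (P v) (P w) + τ (Oc u) (Q v) (P w) + τ (Oc u) (Oc v) (Q w)| ≤
      7 * ‖τ‖ * ‖Q‖ * ‖u‖ * ‖v‖ * ‖w‖ := by
    have a1 : |τ (Q u) (P v) (P w)| ≤ ‖τ‖ * (‖Q‖ * ‖u‖) * (2 * ‖v‖) * (2 * ‖w‖) :=
      (nτ _ _ _).trans (by gcongr <;> first | exact nQ _ | exact nP _)
    have a2 : |τ (Oc u) (Q v) (P w)| ≤ ‖τ‖ * ‖u‖ * (‖Q‖ * ‖v‖) * (2 * ‖w‖) :=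
      (nτ _ _ _).trans (by gcongr <;> first | exact nQ _ | exact nP _ | exact nO _)
    have a3 : |τ (Oc u) (Oc v) (Q w)| ≤ ‖τ‖ * ‖u‖ * ‖v‖ * (‖Q‖ * ‖w‖) :=
      (nτ _ _ _).trans (by gcongr <;> first | exact nQ _ | exact nO _)
    calc _ ≤ |τ (Q u) (P v) (P w) + τ (Oc u) (Q v) (P w)| + |τ (Oc u) (Oc v) (Q w)| :=
          abs_add_le _ _
      _ ≤ (|τ (Q u) (P v) (P w)| + |τ (Oc u) (Q v) (P w)|) + |τ (Oc u) (Oc v) (Q w)| := by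
          gcongr; exact abs_add_le _ _
      _ ≤ (‖τ‖ * (‖Q‖ * ‖u‖) * (2 * ‖v‖) * (2 * ‖w‖) + ‖τ‖ * ‖u‖ * (‖Q‖ * ‖v‖) * (2 * ‖w‖)) +
          ‖τ‖ * ‖u‖ * ‖v‖ * (‖Q‖ * ‖w‖) := add_le_add (add_le_add a1 a2) a3
      _ = 7 * ‖τ‖ * ‖Q‖ * ‖u‖ * ‖v‖ * ‖w‖ := by ring
  have e2 : |k₀ (S u v) (P w) + k₀ (P v) (S u w)| ≤ 4 * ‖k₀‖ * ‖S‖ * ‖u‖ * ‖v‖ * ‖w‖ := by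
    have a1 : |k₀ (S u v) (P w)| ≤ ‖k₀‖ * (‖S‖ * ‖u‖ * ‖v‖) * (2 * ‖w‖) :=
      (nk _ _).trans (by gcongr <;> first | exact nS _ _ | exact nP _)
    have a2 : |k₀ (P v) (S u w)| ≤ ‖k₀‖ * (2 * ‖v‖) * (‖S‖ * ‖u‖ * ‖w‖) :=
      (nk _ _).trans (by gcongr <;> first | exact nS _ _ | exact nP _)
    calc _ ≤ |k₀ (S u v) (P w)| + |k₀ (P v) (S u w)| := abs_add_le _ _
      _ ≤ ‖k₀‖ * (‖S‖ * ‖u‖ * ‖v‖) * (2 * ‖w‖) + ‖k₀‖ * (2 * ‖v‖) * (‖S‖ * ‖u‖ * ‖w‖) :=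
          add_le_add a1 a2
      _ = 4 * ‖k₀‖ * ‖S‖ * ‖u‖ * ‖v‖ * ‖w‖ := by ring
  have e3 : |⟪S u v, Q w⟫ + ⟪Q v, S u w⟫| ≤ 2 * ‖S‖ * ‖Q‖ * ‖u‖ * ‖v‖ * ‖w‖ := by
    have a1 : |⟪S u v, Q w⟫| ≤ (‖S‖ * ‖u‖ * ‖v‖) * (‖Q‖ * ‖w‖) :=
      (abs_real_inner_le_norm _ _).trans (by gcongr <;> first | exact nS _ _ | exact nQ _)
    have a2 : |⟪Q v, S u w⟫| ≤ (‖Q‖ * ‖v‖) * (‖S‖ * ‖u‖ * ‖w‖) :=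
      (abs_real_inner_le_norm _ _).trans (by gcongr <;> first | exact nS _ _ | exact nQ _)
    calc _ ≤ |⟪S u v, Q w⟫| + |⟪Q v, S u w⟫| := abs_add_le _ _
      _ ≤ (‖S‖ * ‖u‖ * ‖v‖) * (‖Q‖ * ‖w‖) + (‖Q‖ * ‖v‖) * (‖S‖ * ‖u‖ * ‖w‖) := add_le_add a1 a2
      _ = 2 * ‖S‖ * ‖Q‖ * ‖u‖ * ‖v‖ * ‖w‖ := by ring
  calc _ ≤ |τ (Q u) (P v) (P w) + τ (Oc u) (Q v) (P w) + τ (Oc u) (Oc v) (Q w) +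
        (k₀ (S u v) (P w) + k₀ (P v) (S u w))| + |⟪S u v, Q w⟫ + ⟪Q v, S u w⟫| := abs_add_le _ _
    _ ≤ (|τ (Q u) (P v) (P w) + τ (Oc u) (Q v) (P w) + τ (Oc u) (Oc v) (Q w)| +
        |k₀ (S u v) (P w) + k₀ (P v) (S u w)|) + |⟪S u v, Q w⟫ + ⟪Q v, S u w⟫| := by
        gcongr; exact abs_add_le _ _
    _ ≤ (7 * ‖τ‖ * ‖Q‖ * ‖u‖ * ‖v‖ * ‖w‖ + 4 * ‖k₀‖ * ‖S‖ * ‖u‖ * ‖v‖ * ‖w‖) +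
        2 * ‖S‖ * ‖Q‖ * ‖u‖ * ‖v‖ * ‖w‖ := add_le_add (add_le_add e1 e2) e3
    _ = _ := by ring

end ErrorAlgebra

/-! ### The ADM vectors: decomposition in an orthonormal frame -/

section Frame

variable {ι : Type*} [Fintype ι] (b : OrthonormalBasis ι ℝ E)

/-- The **curl vector** attached to a symmetric `S : E →L E →L E` (`= D²G(y)`) and the rotation
`O`: `curlVec b O S = ∑ᵢ (∑ⱼ (⟪O bᵢ, S(bⱼ, bⱼ)⟫ − ⟪O bⱼ, S(bⱼ, bᵢ)⟫)) bᵢ`, the ADM vector of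
the family `z ↦ curlGen O (DG z)` (`curlVec_eq_admVec_curlGen`). Bartnik 1986, (4.9).
[cite: Bartnik1986, §4, (4.9)] -/
def curlVec (O : E ≃ₗᵢ[ℝ] E) (S : E →L[ℝ] E →L[ℝ] E) : E :=
  ∑ i, (∑ j, (⟪O (b i), S (b j) (b j)⟫ - ⟪O (b j), S (b j) (b i)⟫)) • b i

/-- **The curl vector is the ADM vector of `β = curlGen O (DG ·)`**: at a `C²` point of `G`,
`∑ᵢ (∑ⱼ (∂ⱼβᵢⱼ − ∂ᵢβⱼⱼ))(y) bᵢ = curlVec b O (D²G(y))`. [folklore] -/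
theorem curlVec_eq_admVec_curlGen (O : E ≃ₗᵢ[ℝ] E) {G : E → E} {y : E}
    (hG : ContDiffAt ℝ 2 G y) :
    ∑ i, (∑ j, (fderiv ℝ (fun z ↦ curlGen O (fderiv ℝ G z) (b i) (b j)) y (b j) -
      fderiv ℝ (fun z ↦ curlGen O (fderiv ℝ G z) (b j) (b j)) y (b i))) • b i =
      curlVec b O (fderiv ℝ (fderiv ℝ G) y) := by
  simp only [fderiv_curlGen_fderiv_apply O hG, sub_self, sub_zero, curlVec]

/-- **Decomposition of the transformed ADM vector.** With the differentiated law and `S`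
symmetric, `admVecOf b τ' − O⁻¹ admVecOf b τ − curlVec b O S` is the frame sum of the error
terms of `abs_error_le`, hence has norm `≤ 2|ι|² ε` where `ε` bounds the error entries on frame
vectors. Bartnik 1986, (4.8)–(4.9). [cite: Bartnik1986, §4, (4.8)–(4.9)] -/
theorem norm_admVecOf_sub_rotate_sub_curlVec_le [FiniteDimensional ℝ E] (O : E ≃ₗᵢ[ℝ] E)
    {S : E →L[ℝ] E →L[ℝ] E}
    (hS : ∀ u v, S u v = S v u) {τ τ' : E →L[ℝ] E →L[ℝ] E →L[ℝ] ℝ} {ε : ℝ}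
    (herr : ∀ i j k : ι, |τ' (b i) (b j) (b k) - τ (O (b i)) (O (b j)) (O (b k)) -
      (⟪S (b i) (b j), O (b k)⟫ + ⟪O (b j), S (b i) (b k)⟫)| ≤ ε) :
    ‖admVecOf b τ' - O.symm (admVecOf b τ) - curlVec b O S‖ ≤
      2 * (Fintype.card ι : ℝ) ^ 2 * ε := by
  set er : E → E → E → ℝ := fun u v w ↦
    τ' u v w - τ (O u) (O v) (O w) - (⟪S u v, O w⟫ + ⟪O v, S u w⟫) with her
  have key : admVecOf b τ' - O.symm (admVecOf b τ) - curlVec b O S =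
      ∑ i, (∑ j, (er (b j) (b i) (b j) - er (b i) (b j) (b j))) • b i := by
    rw [← admVecOf_rotate b O τ, admVecOf, curlVec]
    simp only [← Finset.sum_sub_distrib, ← sub_smul]
    refine Finset.sum_congr rfl fun i _ ↦ ?_
    congr 1
    refine Finset.sum_congr rfl fun j _ ↦ ?_
    simp only [her, hS (b j) (b i), real_inner_comm (O (b j)) (S (b i) (b j))]
    ring
  rw [key]
  have hb : ∀ i, ‖b i‖ = 1 := fun i ↦ b.orthonormal.1 i
  calc ‖∑ i, (∑ j, (er (b j) (b i) (b j) - er (b i) (b j) (b j))) • b i‖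
      ≤ ∑ i, ‖(∑ j, (er (b j) (b i) (b j) - er (b i) (b j) (b j))) • b i‖ := norm_sum_le _ _
    _ ≤ ∑ _i, ∑ _j, 2 * ε := by
        refine Finset.sum_le_sum fun i _ ↦ ?_
        rw [norm_smul, hb i, mul_one, Real.norm_eq_abs]
        refine (Finset.abs_sum_le_sum_abs _ _).trans (Finset.sum_le_sum fun j _ ↦ ?_)
        calc |er (b j) (b i) (b j) - er (b i) (b j) (b j)|
            ≤ |er (b j) (b i) (b j)| + |er (b i) (b j) (b j)| := abs_sub _ _
          _ ≤ ε + ε := add_le_add (herr j i j) (herr i j j)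
          _ = 2 * ε := by ring
    _ = 2 * (Fintype.card ι : ℝ) ^ 2 * ε := by
        simp only [Finset.sum_const, Finset.card_univ, nsmul_eq_mul]
        ring

end Frame

/-! ### The conclusions of the rigidity theorem as a hypothesis structure -/

/-- **Asymptotic rotation bounds** (the conclusions of `TransitionDecay.exists_rotation` beyond
the radius `S₁`, bundled): `‖DG − O‖ ≤ C r^{−α}`, `‖D²G‖ ≤ C r^{−α−1}`, `‖G − O‖ ≤ C r^{1−α}`,
`r/4 ≤ ‖G‖ ≤ 3r`, `‖DG‖ ≤ 2`. Bartnik 1986, Cor. 3.2. [cite: Bartnik1986, §3, Cor. 3.2] -/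
structure RotationBounds (G : E → E) (O : E ≃ₗᵢ[ℝ] E) (α C S₁ : ℝ) : Prop where
  /-- The constant is nonnegative. -/
  C_nonneg : 0 ≤ C
  /-- `‖DG(y) − O‖ ≤ C‖y‖^{−α}`. -/
  norm_fderiv_sub_le : ∀ y, S₁ ≤ ‖y‖ →
    ‖fderiv ℝ G y - ((O.toContinuousLinearEquiv : E ≃L[ℝ] E) : E →L[ℝ] E)‖ ≤ C * ‖y‖ ^ (-α)
  /-- `‖D²G(y)‖ ≤ C‖y‖^{−α−1}`. -/
  norm_fderiv_fderiv_le : ∀ y, S₁ ≤ ‖y‖ → ‖fderiv ℝ (fderiv ℝ G) y‖ ≤ C * ‖y‖ ^ (-α - 1)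
  /-- `‖G(y) − O y‖ ≤ C‖y‖^{1−α}`. -/
  norm_sub_le : ∀ y, S₁ ≤ ‖y‖ → ‖G y - O y‖ ≤ C * ‖y‖ ^ (1 - α)
  /-- `‖y‖/4 ≤ ‖G y‖`. -/
  lower : ∀ y, S₁ ≤ ‖y‖ → ‖y‖ / 4 ≤ ‖G y‖
  /-- `‖G y‖ ≤ 3‖y‖`. -/
  upper : ∀ y, S₁ ≤ ‖y‖ → ‖G y‖ ≤ 3 * ‖y‖
  /-- `‖DG(y)‖ ≤ 2`. -/
  norm_fderiv_le : ∀ y, S₁ ≤ ‖y‖ → ‖fderiv ℝ G y‖ ≤ 2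

/-- The rigidity theorem in bundled form. Bartnik 1986, Cor. 3.2. [cite: Bartnik1986, §3, Cor. 3.2] -/
theorem TransitionDecay.exists_rotationBounds [FiniteDimensional ℝ E]
    {h h' : E → E →L[ℝ] E →L[ℝ] ℝ} {G G' : E → E} {α K R S : ℝ}
    (hd : TransitionDecay h h' G G' α K R S) (h2 : 2 ≤ Module.finrank ℝ E) :
    ∃ (O : E ≃ₗᵢ[ℝ] E) (S₁ C : ℝ), S + 1 ≤ S₁ ∧ RotationBounds G O α C S₁ := by
  obtain ⟨O, S₁, C, hS₁, hC, hall⟩ := hd.exists_rotation h2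
  exact ⟨O, S₁, C, hS₁, ⟨hC, fun y hy ↦ (hall y hy).1, fun y hy ↦ (hall y hy).2.1,
    fun y hy ↦ (hall y hy).2.2.1, fun y hy ↦ (hall y hy).2.2.2.1,
    fun y hy ↦ (hall y hy).2.2.2.2.1, fun y hy ↦ (hall y hy).2.2.2.2.2⟩⟩

/-! ### Pointwise comparison of the ADM vectors -/

/-- The operator norm of a linear isometry is at most `1`. [folklore] -/
theorem norm_coe_isometry_le (O : E ≃ₗᵢ[ℝ] E) :
    ‖((O.toContinuousLinearEquiv : E ≃L[ℝ] E) : E →L[ℝ] E)‖ ≤ 1 := by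
  refine opNorm_le_bound _ zero_le_one fun v ↦ ?_
  rw [one_mul]
  exact le_of_eq (O.norm_map v)

omit [InnerProductSpace ℝ E] in
/-- Powers of `‖G y‖` against powers of `‖y‖`: `‖G y‖^{−s} ≤ 4^s ‖y‖^{−s} ≤ 4^k ‖y‖^{−s}` for
`0 ≤ s ≤ k` when `‖y‖/4 ≤ ‖G y‖`. [folklore] -/
theorem rpow_norm_G_le {G : E → E} {y : E} (hy : 0 < ‖y‖)
    (hlow : ‖y‖ / 4 ≤ ‖G y‖) {s k : ℝ} (hs : 0 ≤ s)
    (hsk : s ≤ k) : ‖G y‖ ^ (-s) ≤ (4 : ℝ) ^ k * ‖y‖ ^ (-s) := by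
  have hq : 0 < ‖y‖ / 4 := by positivity
  calc ‖G y‖ ^ (-s) ≤ (‖y‖ / 4) ^ (-s) := Real.rpow_le_rpow_of_nonpos hq hlow (by linarith)
    _ = (4 : ℝ) ^ s * ‖y‖ ^ (-s) := by
        rw [Real.div_rpow hy.le (by norm_num), div_eq_mul_inv, ← Real.rpow_neg (by norm_num),
          neg_neg, mul_comm]
    _ ≤ (4 : ℝ) ^ k * ‖y‖ ^ (-s) :=
        mul_le_mul_of_nonneg_right (Real.rpow_le_rpow_of_exponent_le (by norm_num) hsk)
          (by positivity)

section Main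

variable [FiniteDimensional ℝ E] {ι : Type*} [Fintype ι] (b : OrthonormalBasis ι ℝ E)
  {h h' : E → E →L[ℝ] E →L[ℝ] ℝ} {G G' : E → E} {α K R S : ℝ}
  {O : E ≃ₗᵢ[ℝ] E} {C S₁ : ℝ}

/-- **The transformed ADM vector, pointwise** (Bartnik 1986, (4.8)–(4.9)): for `‖y‖ ≥ S₁`,
`‖admVecOf b (Dh'(y)) − O⁻¹ admVecOf b (Dh(G y)) − curlVec b O (D²G(y))‖ ≤
2|ι|² (130 K C + 2 C²) ‖y‖^{−2α−1}`. [cite: Bartnik1986, §4, (4.8)–(4.9)] -/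
theorem norm_admVecOf_sub_le (hd : TransitionDecay h h' G G' α K R S)
    (hr : RotationBounds G O α C S₁) (hS₁ : S + 1 ≤ S₁) {y : E} (hy : S₁ ≤ ‖y‖) :
    ‖admVecOf b (fderiv ℝ h' y) - O.symm (admVecOf b (fderiv ℝ h (G y))) -
        curlVec b O (fderiv ℝ (fderiv ℝ G) y)‖ ≤
      2 * (Fintype.card ι : ℝ) ^ 2 * ((130 * K * C + 2 * C ^ 2) * ‖y‖ ^ (-2 * α - 1)) := by
  have hα := hd.α_pos
  have hα1 := hd.α_lt_one
  have hK := hd.K_nonneg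
  have hC := hr.C_nonneg
  have hyS : S < ‖y‖ := by linarith
  have hy0 : 0 < ‖y‖ := by linarith [hd.one_le_S]
  have hGy : R < ‖G y‖ := hd.lt_norm_G hyS
  set Oc : E →L[ℝ] E := ((O.toContinuousLinearEquiv : E ≃L[ℝ] E) : E →L[ℝ] E) with hOc
  have hOapp : ∀ v, Oc v = O v := fun v ↦ rfl
  -- the differentiated law at `y`
  have hG2 : ContDiffAt ℝ 2 G y := (hd.contDiffAt_G y hyS).of_le (WithTop.coe_le_coe.mpr le_top)
  have hlaw_ev : ∀ᶠ z in 𝓝 y, ∀ v w, h' z v w = h (G z) (fderiv ℝ G z v) (fderiv ℝ G z w) := by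
    filter_upwards [(isOpen_lt continuous_const continuous_norm).mem_nhds hyS] with z hz
    exact hd.law z hz
  have hh : DifferentiableAt ℝ h (G y) := (hd.contDiffAt_h _ hGy).differentiableAt (by simp)
  have hh' : DifferentiableAt ℝ h' y := (hd.contDiffAt_h' _ hyS).differentiableAt (by simp)
  have hdlaw := fun u v w ↦ fderiv_law_apply hlaw_ev hG2 hh hh' u v w
  have hS : ∀ u v, fderiv ℝ (fderiv ℝ G) y u v = fderiv ℝ (fderiv ℝ G) y v u := fun u v ↦
    (hG2.isSymmSndFDerivAt (by rw [minSmoothness_of_isRCLikeNormedField])).eq u v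
  -- the error entries on frame vectors
  set P := fderiv ℝ G y with hP
  set SS := fderiv ℝ (fderiv ℝ G) y with hSS
  set τ := fderiv ℝ h (G y) with hτ
  set τ' := fderiv ℝ h' y with hτ'
  set ε : ℝ := (7 * ‖τ‖ * ‖P - Oc‖ + 4 * ‖h (G y) - innerSL ℝ‖ * ‖SS‖ + 2 * ‖SS‖ * ‖P - Oc‖)
    with hε
  have herr : ∀ i j k : ι, |τ' (b i) (b j) (b k) - τ (O (b i)) (O (b j)) (O (b k)) -
      (⟪SS (b i) (b j), O (b k)⟫ + ⟪O (b j), SS (b i) (b k)⟫)| ≤ ε := by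
    intro i j k
    have h0 := abs_error_le (h₀ := h (G y)) (P := P) (Oc := Oc) (S := SS) (τ := τ) (τ' := τ')
      (hr.norm_fderiv_le y hy) (norm_coe_isometry_le O) hdlaw (b i) (b j) (b k)
    simp only [hOapp, b.orthonormal.1, mul_one] at h0
    exact h0
  have hmain := norm_admVecOf_sub_rotate_sub_curlVec_le b O hS herr
  refine hmain.trans (mul_le_mul_of_nonneg_left ?_ (by positivity))
  -- `ε ≤ (130 K C + 2 C²) ‖y‖^{-2α-1}`
  have e1 : ‖τ‖ ≤ K * ((4 : ℝ) ^ (2 : ℝ) * ‖y‖ ^ (-(α + 1))) := by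
    refine (hd.norm_fderiv_h_le _ hGy).trans (mul_le_mul_of_nonneg_left ?_ hK)
    rw [show (-α - 1) = -(α + 1) by ring]
    exact rpow_norm_G_le hy0 (hr.lower y hy) (by linarith) (by linarith)
  have e2 : ‖h (G y) - innerSL ℝ‖ ≤ K * ((4 : ℝ) ^ (1 : ℝ) * ‖y‖ ^ (-α)) := by
    refine (hd.norm_h_sub_le _ hGy).trans (mul_le_mul_of_nonneg_left ?_ hK)
    exact rpow_norm_G_le hy0 (hr.lower y hy) hα.le hα1.le
  have e3 : ‖P - Oc‖ ≤ C * ‖y‖ ^ (-α) := hr.norm_fderiv_sub_le y hy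
  have e4 : ‖SS‖ ≤ C * ‖y‖ ^ (-α - 1) := hr.norm_fderiv_fderiv_le y hy
  have hp1 : ‖y‖ ^ (-(α + 1)) * ‖y‖ ^ (-α) = ‖y‖ ^ (-2 * α - 1) := by
    rw [← Real.rpow_add hy0]; congr 1; ring
  have hp2 : ‖y‖ ^ (-α) * ‖y‖ ^ (-α - 1) = ‖y‖ ^ (-2 * α - 1) := by
    rw [← Real.rpow_add hy0]; congr 1; ring
  have hτ0 : 0 ≤ ‖τ‖ := norm_nonneg _
  have hQ0 : 0 ≤ ‖P - Oc‖ := norm_nonneg _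
  have hS0 : 0 ≤ ‖SS‖ := norm_nonneg _
  have hk0 : 0 ≤ ‖h (G y) - innerSL ℝ‖ := norm_nonneg _
  calc ε = 7 * ‖τ‖ * ‖P - Oc‖ + 4 * ‖h (G y) - innerSL ℝ‖ * ‖SS‖ + 2 * ‖SS‖ * ‖P - Oc‖ := hε
    _ ≤ 7 * (K * ((4 : ℝ) ^ (2 : ℝ) * ‖y‖ ^ (-(α + 1)))) * (C * ‖y‖ ^ (-α)) +
        4 * (K * ((4 : ℝ) ^ (1 : ℝ) * ‖y‖ ^ (-α))) * (C * ‖y‖ ^ (-α - 1)) +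
        2 * (C * ‖y‖ ^ (-α - 1)) * (C * ‖y‖ ^ (-α)) := by
        gcongr
    _ = (112 * K * C) * (‖y‖ ^ (-(α + 1)) * ‖y‖ ^ (-α)) +
        (16 * K * C) * (‖y‖ ^ (-α) * ‖y‖ ^ (-α - 1)) +
        (2 * C ^ 2) * (‖y‖ ^ (-α) * ‖y‖ ^ (-α - 1)) := by norm_num; ring
    _ = (128 * K * C + 2 * C ^ 2) * ‖y‖ ^ (-2 * α - 1) := by rw [hp1, hp2]; ring
    _ ≤ (130 * K * C + 2 * C ^ 2) * ‖y‖ ^ (-2 * α - 1) := by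
        gcongr; linarith [mul_nonneg hK hC]

omit [FiniteDimensional ℝ E] in
/-- **Moving the base point from `G y` to `O y`** (Bartnik 1986, proof of Thm. 4.2): the ADM
field `V = ∑ᵢ (∑ⱼ (∂ⱼhᵢⱼ − ∂ᵢhⱼⱼ)) bᵢ` of `h` satisfies
`‖V(G y) − V(O y)‖ ≤ 16|ι|² K C ‖y‖^{−2α−1}` for `‖y‖` large: the segment from `O y` to `G y` has
length `≤ C‖y‖^{1−α} ≤ ‖y‖/2` and stays in `{‖x‖ ≥ ‖y‖/2}`, where `‖DV‖ ≤ 2|ι|²‖D²h‖ ≤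
16|ι|² K ‖y‖^{−α−2}` (mean value inequality). [cite: Bartnik1986, §4, Thm. 4.2] -/
theorem exists_norm_admVec_G_sub_admVec_O_le (hd : TransitionDecay h h' G G' α K R S)
    (hr : RotationBounds G O α C S₁) {V : E → E}
    (hV : ∀ x, V x = ∑ i, (∑ j, (fderiv ℝ (fun z ↦ h z (b i) (b j)) x (b j) -
      fderiv ℝ (fun z ↦ h z (b j) (b j)) x (b i))) • b i) :
    ∃ S₂ : ℝ, S₁ ≤ S₂ ∧ ∀ y : E, S₂ ≤ ‖y‖ →
      ‖V (G y) - V (O y)‖ ≤ 16 * (Fintype.card ι : ℝ) ^ 2 * K * C * ‖y‖ ^ (-2 * α - 1) := by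
  have hα := hd.α_pos
  have hK := hd.K_nonneg
  have hC := hr.C_nonneg
  -- beyond `S₃`, `C r^{-α} ≤ 1/2`
  have hev : ∀ᶠ r : ℝ in atTop, C * r ^ (-α) ≤ 1 / 2 := by
    have ht : Tendsto (fun r : ℝ ↦ C * r ^ (-α)) atTop (𝓝 0) := by
      simpa using (tendsto_rpow_neg_atTop hα).const_mul C
    exact ht.eventually (Iic_mem_nhds (by norm_num))
  obtain ⟨S₃, hS₃⟩ := Filter.eventually_atTop.1 hev
  refine ⟨max S₁ (max (2 * R + 2) S₃), le_max_left _ _, fun y hy ↦ ?_⟩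
  have hyS₁ : S₁ ≤ ‖y‖ := (le_max_left _ _).trans hy
  have hyR : 2 * R + 2 ≤ ‖y‖ := (le_max_left _ _).trans ((le_max_right _ _).trans hy)
  have hyS₃ : S₃ ≤ ‖y‖ := (le_max_right _ _).trans ((le_max_right _ _).trans hy)
  have hy0 : 0 < ‖y‖ := by linarith [hd.one_le_R]
  -- the segment stays in `{‖x‖ ≥ ‖y‖/2}`
  have hlen : ‖G y - O y‖ ≤ ‖y‖ / 2 := by
    calc ‖G y - O y‖ ≤ C * ‖y‖ ^ (1 - α) := hr.norm_sub_le y hyS₁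
      _ = C * ‖y‖ ^ (-α) * ‖y‖ := by
          rw [show (1 - α) = (-α) + 1 by ring, Real.rpow_add hy0, Real.rpow_one]; ring
      _ ≤ 1 / 2 * ‖y‖ := mul_le_mul_of_nonneg_right (hS₃ _ hyS₃) hy0.le
      _ = ‖y‖ / 2 := by ring
  have hseg : ∀ z ∈ segment ℝ (O y) (G y), ‖y‖ / 2 ≤ ‖z‖ := by
    intro z hz
    obtain ⟨a, c, ha, hc, hac, rfl⟩ := hz
    have hz : a • O y + c • G y = O y + c • (G y - O y) := by
      rw [smul_sub, show a = 1 - c by linarith]; simp [sub_smul]; abel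
    rw [hz]
    have h1 : ‖c • (G y - O y)‖ ≤ ‖y‖ / 2 := by
      rw [norm_smul, Real.norm_of_nonneg hc]
      calc c * ‖G y - O y‖ ≤ 1 * (‖y‖ / 2) := by gcongr; linarith
        _ = ‖y‖ / 2 := one_mul _
    have h2 := norm_sub_norm_le (O y) (-(c • (G y - O y)))
    rw [sub_neg_eq_add, norm_neg, O.norm_map] at h2
    linarith
  have hfar : ∀ z ∈ segment ℝ (O y) (G y), R < ‖z‖ := fun z hz ↦ by
    have := hseg z hz; linarith
  -- derivative of `V` on the segment
  have hVd : ∀ z ∈ segment ℝ (O y) (G y), DifferentiableAt ℝ V z := fun z hz ↦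
    (hasFDerivAt_admVec b hV ((hd.contDiffAt_h z (hfar z hz)).of_le
      (WithTop.coe_le_coe.mpr le_top))).differentiableAt
  have hVb : ∀ z ∈ segment ℝ (O y) (G y),
      ‖fderiv ℝ V z‖ ≤ 2 * (Fintype.card ι : ℝ) ^ 2 * (K * ((2 : ℝ) ^ (3 : ℝ) * ‖y‖ ^ (-(α + 2)))) := by
    intro z hz
    have hz2 : ContDiffAt ℝ 2 h z :=
      (hd.contDiffAt_h z (hfar z hz)).of_le (WithTop.coe_le_coe.mpr le_top)
    refine opNorm_le_bound _ (by positivity) fun a ↦ ?_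
    rw [fderiv_admVec_apply b hV hz2 a]
    refine (norm_admVecOf_le b _).trans ?_
    have h1 : ‖fderiv ℝ (fderiv ℝ h) z a‖ ≤ ‖fderiv ℝ (fderiv ℝ h) z‖ * ‖a‖ := le_opNorm _ _
    have h2 : ‖fderiv ℝ (fderiv ℝ h) z‖ ≤ K * ((2 : ℝ) ^ (3 : ℝ) * ‖y‖ ^ (-(α + 2))) := by
      refine (hd.norm_fderiv_fderiv_h_le z (hfar z hz)).trans (mul_le_mul_of_nonneg_left ?_ hK)
      have hq : 0 < ‖y‖ / 2 := by positivity
      calc ‖z‖ ^ (-α - 2) ≤ (‖y‖ / 2) ^ (-α - 2) :=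
            Real.rpow_le_rpow_of_nonpos hq (hseg z hz) (by linarith)
        _ = (2 : ℝ) ^ (α + 2) * ‖y‖ ^ (-(α + 2)) := by
            rw [Real.div_rpow hy0.le (by norm_num), div_eq_mul_inv, ← Real.rpow_neg (by norm_num),
              show (-(-α - 2)) = α + 2 by ring, show (-α - 2) = -(α + 2) by ring, mul_comm]
        _ ≤ (2 : ℝ) ^ (3 : ℝ) * ‖y‖ ^ (-(α + 2)) :=
            mul_le_mul_of_nonneg_right
              (Real.rpow_le_rpow_of_exponent_le (by norm_num) (by linarith [hd.α_lt_one]))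
              (by positivity)
    calc 2 * (Fintype.card ι : ℝ) ^ 2 * ‖fderiv ℝ (fderiv ℝ h) z a‖
        ≤ 2 * (Fintype.card ι : ℝ) ^ 2 * (K * ((2 : ℝ) ^ (3 : ℝ) * ‖y‖ ^ (-(α + 2))) * ‖a‖) := by
          gcongr; exact h1.trans (mul_le_mul_of_nonneg_right h2 (norm_nonneg a))
      _ = _ := by ring
  have hmvt := Convex.norm_image_sub_le_of_norm_fderiv_le (𝕜 := ℝ) hVd hVb
    (convex_segment _ _) (left_mem_segment _ _ _) (right_mem_segment _ _ _)
  refine hmvt.trans ?_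
  have hp : ‖y‖ ^ (-(α + 2)) * ‖y‖ ^ (1 - α) = ‖y‖ ^ (-2 * α - 1) := by
    rw [← Real.rpow_add hy0]; congr 1; ring
  calc 2 * (Fintype.card ι : ℝ) ^ 2 * (K * ((2 : ℝ) ^ (3 : ℝ) * ‖y‖ ^ (-(α + 2)))) * ‖G y - O y‖
      ≤ 2 * (Fintype.card ι : ℝ) ^ 2 * (K * ((2 : ℝ) ^ (3 : ℝ) * ‖y‖ ^ (-(α + 2)))) *
        (C * ‖y‖ ^ (1 - α)) := by gcongr; exact hr.norm_sub_le y hyS₁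
    _ = 16 * (Fintype.card ι : ℝ) ^ 2 * K * C * (‖y‖ ^ (-(α + 2)) * ‖y‖ ^ (1 - α)) := by
        norm_num; ring
    _ = _ := by rw [hp]

/-- **The flux densities of the two structures at infinity, pointwise on round spheres**
(Bartnik 1986, (4.8)–(4.9), "a curious cancellation", in the round-sphere form). Let `V`, `V'` be
the ADM flux density fields of `h`, `h'` in the orthonormal frame `b`, and `c` the ADM vector of a
family `β` agreeing with `curlGen O (DG ·)` near every point of `{S + 2 < ‖z‖}`. Then there are
`S⋆`, `C⋆ ≥ 0` with
`|⟪y/‖y‖, V'(y)⟫ − ⟪Oy/‖Oy‖, V(Oy)⟫ − ⟪y/‖y‖, c(y)⟫| ≤ C⋆ ‖y‖^{−2α−1}` for all `‖y‖ ≥ S⋆`.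
[cite: Bartnik1986, §4, (4.8)–(4.9), Thm. 4.2] -/
theorem exists_abs_flux_density_sub_le (hd : TransitionDecay h h' G G' α K R S)
    (hr : RotationBounds G O α C S₁) (hS₁ : S + 1 ≤ S₁) {V V' : E → E}
    (hV : ∀ x, V x = ∑ i, (∑ j, (fderiv ℝ (fun z ↦ h z (b i) (b j)) x (b j) -
      fderiv ℝ (fun z ↦ h z (b j) (b j)) x (b i))) • b i)
    (hV' : ∀ y, V' y = ∑ i, (∑ j, (fderiv ℝ (fun z ↦ h' z (b i) (b j)) y (b j) -
      fderiv ℝ (fun z ↦ h' z (b j) (b j)) y (b i))) • b i)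
    {β : E → E →L[ℝ] E →L[ℝ] ℝ}
    (hβ : ∀ z, S + 2 < ‖z‖ → β =ᶠ[𝓝 z] fun z ↦ curlGen O (fderiv ℝ G z))
    {c : E → E}
    (hc : ∀ y, c y = ∑ i, (∑ j, (fderiv ℝ (fun z ↦ β z (b i) (b j)) y (b j) -
      fderiv ℝ (fun z ↦ β z (b j) (b j)) y (b i))) • b i) :
    ∃ Sstar Cstar : ℝ, S₁ ≤ Sstar ∧ 0 ≤ Cstar ∧ ∀ y : E, Sstar ≤ ‖y‖ →
      |⟪‖y‖⁻¹ • y, V' y⟫ - ⟪‖O y‖⁻¹ • O y, V (O y)⟫ - ⟪‖y‖⁻¹ • y, c y⟫| ≤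
        Cstar * ‖y‖ ^ (-2 * α - 1) := by
  have hK := hd.K_nonneg
  have hC := hr.C_nonneg
  obtain ⟨S₂, hS₂, hVG⟩ := exists_norm_admVec_G_sub_admVec_O_le b hd hr hV
  set n : ℝ := (Fintype.card ι : ℝ) with hn
  refine ⟨max S₂ (S + 3), 2 * n ^ 2 * (130 * K * C + 2 * C ^ 2) + 16 * n ^ 2 * K * C,
    (hS₂).trans (le_max_left _ _), by positivity, fun y hy ↦ ?_⟩
  have hyS₂ : S₂ ≤ ‖y‖ := (le_max_left _ _).trans hy
  have hyS₁ : S₁ ≤ ‖y‖ := hS₂.trans hyS₂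
  have hyS : S < ‖y‖ := by linarith
  have hyS2 : S + 2 < ‖y‖ := by have := le_max_right S₂ (S + 3); linarith
  have hy0 : 0 < ‖y‖ := by linarith [hd.one_le_S]
  have hGy : R < ‖G y‖ := hd.lt_norm_G hyS
  -- identify the three fields at `y`
  have hh : DifferentiableAt ℝ h (G y) := (hd.contDiffAt_h _ hGy).differentiableAt (by simp)
  have hh' : DifferentiableAt ℝ h' y := (hd.contDiffAt_h' _ hyS).differentiableAt (by simp)
  have hG2 : ContDiffAt ℝ 2 G y := (hd.contDiffAt_G y hyS).of_le (WithTop.coe_le_coe.mpr le_top)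
  have eV' : V' y = admVecOf b (fderiv ℝ h' y) := admVec_eq_admVecOf b hV' hh'
  have eV : V (G y) = admVecOf b (fderiv ℝ h (G y)) := admVec_eq_admVecOf b hV hh
  have ec : c y = curlVec b O (fderiv ℝ (fderiv ℝ G) y) := by
    rw [hc y, ← curlVec_eq_admVec_curlGen b O hG2]
    have hcomp : ∀ v w, (fun z ↦ β z v w) =ᶠ[𝓝 y] fun z ↦ curlGen O (fderiv ℝ G z) v w :=
      fun v w ↦ (hβ y hyS2).mono fun z hz ↦ congrArg (fun B : E →L[ℝ] E →L[ℝ] ℝ ↦ B v w) hz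
    simp only [(hcomp _ _).fderiv_eq]
  -- the decomposition
  set w₁ := admVecOf b (fderiv ℝ h' y) - O.symm (admVecOf b (fderiv ℝ h (G y))) -
    curlVec b O (fderiv ℝ (fderiv ℝ G) y) with hw₁
  set w₂ := V (G y) - V (O y) with hw₂
  have hOy : ‖O y‖ = ‖y‖ := O.norm_map y
  have key : ⟪‖y‖⁻¹ • y, V' y⟫ - ⟪‖O y‖⁻¹ • O y, V (O y)⟫ - ⟪‖y‖⁻¹ • y, c y⟫ =
      ⟪‖y‖⁻¹ • y, w₁⟫ + ⟪‖O y‖⁻¹ • O y, w₂⟫ := by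
    have hrot : ⟪‖y‖⁻¹ • y, O.symm (admVecOf b (fderiv ℝ h (G y)))⟫ =
        ⟪‖O y‖⁻¹ • O y, V (G y)⟫ := by
      rw [eV, hOy, ← O.inner_map_map, O.apply_symm_apply, O.map_smul]
    rw [hw₁, hw₂, eV', ec, inner_sub_right, inner_sub_right, inner_sub_right, hrot]
    ring
  rw [key]
  have n1 : ‖‖y‖⁻¹ • y‖ ≤ 1 := by
    rw [norm_smul, norm_inv, norm_norm, inv_mul_cancel₀ hy0.ne']
  have n2 : ‖‖O y‖⁻¹ • O y‖ ≤ 1 := by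
    rw [norm_smul, norm_inv, norm_norm, hOy, inv_mul_cancel₀ hy0.ne']
  have b1 : |⟪‖y‖⁻¹ • y, w₁⟫| ≤ ‖w₁‖ := by
    calc _ ≤ ‖‖y‖⁻¹ • y‖ * ‖w₁‖ := abs_real_inner_le_norm _ _
      _ ≤ 1 * ‖w₁‖ := by gcongr
      _ = ‖w₁‖ := one_mul _
  have b2 : |⟪‖O y‖⁻¹ • O y, w₂⟫| ≤ ‖w₂‖ := by
    calc _ ≤ ‖‖O y‖⁻¹ • O y‖ * ‖w₂‖ := abs_real_inner_le_norm _ _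
      _ ≤ 1 * ‖w₂‖ := by gcongr
      _ = ‖w₂‖ := one_mul _
  have c1 := norm_admVecOf_sub_le b hd hr hS₁ hyS₁
  have c2 := hVG y hyS₂
  calc |⟪‖y‖⁻¹ • y, w₁⟫ + ⟪‖O y‖⁻¹ • O y, w₂⟫| ≤ |⟪‖y‖⁻¹ • y, w₁⟫| + |⟪‖O y‖⁻¹ • O y, w₂⟫| :=
        abs_add_le _ _
    _ ≤ ‖w₁‖ + ‖w₂‖ := add_le_add b1 b2
    _ ≤ 2 * n ^ 2 * ((130 * K * C + 2 * C ^ 2) * ‖y‖ ^ (-2 * α - 1)) +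
        16 * n ^ 2 * K * C * ‖y‖ ^ (-2 * α - 1) := add_le_add c1 c2
    _ = _ := by ring

end Main

end TransitionRigidity

end Literature.Geometry.Lorentzian

end
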